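import Summits.CriticalPhenomena.Ising3DConformalLimit.Theses.MonotoneBlocking
import Summits.CriticalPhenomena.Ising3DConformalLimit.Theses.MirrorHoelderCompactness
import Summits.CriticalPhenomena.Ising3DConformalLimit.Theorems.MonotoneBlockingNonSeparableModulusAxialPincerCore
import Summits.CriticalPhenomena.Ising3DConformalLimit.Theorems.HyperoctahedralRPExistsScaleCovariantLimitNonSeparableModulusOfUniformRegularity
import Summits.CriticalPhenomena.Ising3DConformalLimit.Theorems.HyperoctahedralRPExistsScaleCovariantLimitCompactnessItemMapsDoubling
import HarnessLib

/-!
# Axial pincer: `NonSeparableModulus → TwoPointDoubling` (item stmt-CriticalPhenomena-6152 ⟹ item 6150)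

Routes `MonotoneBlocking` / `MirrorHoelderCompactness` (the two route decls `NonSeparableModulus` are the same
proposition), sub-problem `CriticalPhenomena/Ising3DConformalLimit`. Helper file 2/2 of the lead's landing of the
crux-ideate evidence `AxialPincer.lean` (line `AxialPincer` of crux 6152); no definitions, no notation (every
object below is written out: `e₀ = EuclideanSpace.single 0 1`, `𝔵₀ = fun i => (![0, 1/2, 1, 2] i) • e₀`,
`ρ★ = fun δ => ⟨σ₀σ_{⌊δ⁻¹⌋e₀}⟩^{-1/2}` verbatim as in the route decl, mesh `1/(2n) = ((2 * n : ℕ) : ℝ)⁻¹`,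
`g(k) = criticalTwoPoint 3 (Pi.single 0 k)`), no named-fact hypotheses, no `sorry`.

MAIN THEOREMS
* `twoPointDoubling_of_nonSeparableModulus : MonotoneBlocking.NonSeparableModulus → MirrorHoelderCompactness.TwoPointDoubling`
  (the NEW direction 6152 ⟹ 6150);
* `nonSeparableModulus_iff_twoPointDoubling : MonotoneBlocking.NonSeparableModulus ↔ MirrorHoelderCompactness.TwoPointDoubling`
  (with the landed converse 6150 ⟹ 4658 ⟹ 6152: `ItemMaps.uniformRegularity_of_doubling`,
  `TwoHierarchies.stub_nonSeparableModulus_of_uniformRegularity`); `mirror_…` = the `MirrorHoelderCompactness` copy.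

MECHANISM (the "axial pincer"). `g(k) = ⟨σ₀σ_{k e₀}⟩_{β_c}`, `F_n^δ = ρ★(δ)ⁿ⟨∏σ_{⌊x_i/δ⌋}⟩`,
`ρ★(δ) = ⟨σ₀σ_{⌊δ⁻¹⌋e₀}⟩^{-1/2}`. Take `n = 4` and the collinear configuration `𝔵₀ = (0, ½, 1, 2)·e₀`: its point
`𝔵₀ 1 = ½e₀` lies strictly between `𝔵₀ 0` and `𝔵₀ 2`, so it is NOT `m`-separable by ANY vector, for any `m > 0`
(`x0_caged`) — mesh `δ = 1/(2n)` (lattice sites `0, n, 2n, 4n` on the axis) and the retreated point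
`y = ((n−J)/(2n))·e₀`, `J = ⌊n/p⌋ + 1`. By the scalar core (file `…AxialPincerCore`):
`F₄^δ(𝔵₀) ≤ 4 g(n)/g(2n) + 1` (`F_x0_le`), `F₄^δ(update 𝔵₀ 1 y) ≥ g(n−J)/g(2n) − 1` (`F_update_ge`), and a
doubling defect `g(2n) < κ g(n)`, `κ ≤ 8^{-p}`, forces `8 g(n) ≤ g(n−J)` (`eight_mul_axis_le_of_ratio_lt`).
If doubling failed, pick the defect scale `n` beyond the NS thresholds (`δ < δ₀`, `J/(2n) < η`): NS at `ε = 1`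
gives `g(n−J) < 4 g(n) + 3 g(2n) ≤ 7 g(n)` — contradiction.

CONSEQUENCE. NS is EXACTLY all-scale axial doubling (item 6150 ⟺ 4658 ⟺ 5955 by the landed item maps): the
crux has no content independent of item 6150, and closes the moment `TwoPointDoubling` lands
(`Cruxes/NonSeparableModulus/Lines/AxialPincer.lean`, `NonSeparableModulus_of`).

References: M. Aizenman, H. Duminil-Copin, Ann. of Math. 194 (2021), arXiv:1912.07973, eq. (3.12), Prop. 5.3/5.9,
Remark 5.10 [AizenmanDuminilCopinAnnals2021]; A. Messager, S. Miracle-Solé, J. Stat. Phys. 17 (1977)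
[MessagerMiracleSoleJSP1977]. Adapted from `Cruxes/NonSeparableModulus/AxialPincer.lean`
(planner-cruxidea-stmt-CriticalPhenomena-6152-2-0, sorry-free evidence of 2026-08-17).
-/

noncomputable section

namespace Summit.CriticalPhenomena.Ising3DConformalLimit.MonotoneBlockingNonSeparableModulusAxialPincer

open Literature.Probability.LatticeModels
open Summit.CriticalPhenomena.Ising3DConformalLimit.Theses

/-! ### The collinear test configuration and its lattice shadows -/

/-- Coordinates of `c • e₀`. [folklore] -/
theorem smul_e0_apply (c : ℝ) (k : Fin 3) : (c • (EuclideanSpace.single 0 (1 : ℝ) : EuclideanSpace ℝ (Fin 3))) k = if k = 0 then c else 0 := by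
  by_cases hk : k = 0
  · subst hk; simp
  · simp [hk]

/-- `⌊(c e₀)_k / δ⌋ = ⌊c/δ⌋ e₀`. [folklore] -/
theorem latticeApprox_smul_e0 (δ c : ℝ) : latticeApprox δ (c • (EuclideanSpace.single 0 (1 : ℝ) : EuclideanSpace ℝ (Fin 3))) = Pi.single 0 ⌊c / δ⌋ := by
  funext k
  rw [latticeApprox_apply, smul_e0_apply]
  by_cases hk : k = 0
  · subst hk; simp
  · simp [hk]

/-- At mesh `1/(2n)`, the point `c e₀` with `c · 2n = k ∈ ℕ` sits on the site `k e₀`. [folklore] -/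
theorem latticeApprox_smul_e0_eq {n : ℕ} (c : ℝ) (k : ℕ) (hck : c * ((2 * n : ℕ) : ℝ) = k) :
    latticeApprox ((2 * n : ℕ) : ℝ)⁻¹ (c • (EuclideanSpace.single 0 (1 : ℝ) : EuclideanSpace ℝ (Fin 3))) = (Pi.single 0 (k : ℤ) : Site 3) := by
  rw [latticeApprox_smul_e0, div_inv_eq_mul, hck, Int.floor_natCast]

/-- `⟪u, c e₀⟫ = c ⟪u, e₀⟫`. [folklore] -/
theorem inner_smul_e0 (u : EuclideanSpace ℝ (Fin 3)) (c : ℝ) : inner ℝ u (c • (EuclideanSpace.single 0 (1 : ℝ) : EuclideanSpace ℝ (Fin 3))) = c * inner ℝ u (EuclideanSpace.single 0 (1 : ℝ) : EuclideanSpace ℝ (Fin 3)) := by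
  rw [real_inner_smul_right]

/-- `(0, ½, 1, 2)₀ = 0`. [folklore] -/
theorem vec4_zero : (![0, 1 / 2, 1, 2] : Fin 4 → ℝ) 0 = 0 := rfl

/-- `(0, ½, 1, 2)₁ = ½`. [folklore] -/
theorem vec4_one : (![0, 1 / 2, 1, 2] : Fin 4 → ℝ) 1 = 1 / 2 := rfl

/-- `(0, ½, 1, 2)₂ = 1`. [folklore] -/
theorem vec4_two : (![0, 1 / 2, 1, 2] : Fin 4 → ℝ) 2 = 1 := rfl

/-- `𝔵₀` is a non-coincident configuration. [folklore] -/
theorem x0_mem : (fun i : Fin 4 => ((![0, 1 / 2, 1, 2] : Fin 4 → ℝ) i) • (EuclideanSpace.single 0 (1 : ℝ) : EuclideanSpace ℝ (Fin 3))) ∈ NonCoincident 3 4 := by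
  rw [mem_nonCoincident]
  intro i j h
  have h' := congrArg (fun v : EuclideanSpace ℝ (Fin 3) => v 0) h
  simp only [smul_e0_apply, if_true] at h'
  fin_cases i <;> fin_cases j <;> first | rfl | norm_num at h'

/-- **The midpoint `𝔵₀ 1` is caged**: it is not `m`-separable from the other three points by any vector `u`
whatsoever, for any `m > 0` (it lies strictly between `𝔵₀ 0` and `𝔵₀ 2` on a line). [folklore] -/
theorem x0_caged {m : ℝ} (hm : 0 < m) (u : EuclideanSpace ℝ (Fin 3)) :
    ¬ ((∀ j : Fin 4, j ≠ 1 → inner ℝ u ((fun i : Fin 4 => ((![0, 1 / 2, 1, 2] : Fin 4 → ℝ) i) • (EuclideanSpace.single 0 (1 : ℝ) : EuclideanSpace ℝ (Fin 3))) j) + m ≤ inner ℝ u ((fun i : Fin 4 => ((![0, 1 / 2, 1, 2] : Fin 4 → ℝ) i) • (EuclideanSpace.single 0 (1 : ℝ) : EuclideanSpace ℝ (Fin 3))) 1)) ∨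
       (∀ j : Fin 4, j ≠ 1 → inner ℝ u ((fun i : Fin 4 => ((![0, 1 / 2, 1, 2] : Fin 4 → ℝ) i) • (EuclideanSpace.single 0 (1 : ℝ) : EuclideanSpace ℝ (Fin 3))) 1) + m ≤ inner ℝ u ((fun i : Fin 4 => ((![0, 1 / 2, 1, 2] : Fin 4 → ℝ) i) • (EuclideanSpace.single 0 (1 : ℝ) : EuclideanSpace ℝ (Fin 3))) j))) := by
  rintro (h | h)
  · have h0 := h 0 (by decide)
    have h2 := h 2 (by decide)
    simp only [inner_smul_e0, vec4_zero, vec4_one, vec4_two] at h0 h2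
    linarith
  · have h0 := h 0 (by decide)
    have h2 := h 2 (by decide)
    simp only [inner_smul_e0, vec4_zero, vec4_one, vec4_two] at h0 h2
    linarith

/-- Lattice shadow of `𝔵₀` at mesh `1/(2n)`: the axis sites `(0, n, 2n, 4n)·e₀`. [folklore] -/
theorem latticeApprox_x0 (n : ℕ) :
    (fun i => latticeApprox ((2 * n : ℕ) : ℝ)⁻¹ ((fun i : Fin 4 => ((![0, 1 / 2, 1, 2] : Fin 4 → ℝ) i) • (EuclideanSpace.single 0 (1 : ℝ) : EuclideanSpace ℝ (Fin 3))) i)) = ![(Pi.single 0 ((0 : ℕ) : ℤ) : Site 3), (Pi.single 0 (n : ℤ) : Site 3), (Pi.single 0 ((2 * n : ℕ) : ℤ) : Site 3), (Pi.single 0 ((4 * n : ℕ) : ℤ) : Site 3)] := by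
  funext i
  fin_cases i
  · show latticeApprox ((2 * n : ℕ) : ℝ)⁻¹ ((0 : ℝ) • (EuclideanSpace.single 0 (1 : ℝ) : EuclideanSpace ℝ (Fin 3))) = (Pi.single 0 ((0 : ℕ) : ℤ) : Site 3)
    exact latticeApprox_smul_e0_eq _ _ (by simp)
  · show latticeApprox ((2 * n : ℕ) : ℝ)⁻¹ ((1 / 2 : ℝ) • (EuclideanSpace.single 0 (1 : ℝ) : EuclideanSpace ℝ (Fin 3))) = (Pi.single 0 (n : ℤ) : Site 3)
    exact latticeApprox_smul_e0_eq _ _ (by push_cast; ring)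
  · show latticeApprox ((2 * n : ℕ) : ℝ)⁻¹ ((1 : ℝ) • (EuclideanSpace.single 0 (1 : ℝ) : EuclideanSpace ℝ (Fin 3))) = (Pi.single 0 ((2 * n : ℕ) : ℤ) : Site 3)
    exact latticeApprox_smul_e0_eq _ _ (by ring)
  · show latticeApprox ((2 * n : ℕ) : ℝ)⁻¹ ((2 : ℝ) • (EuclideanSpace.single 0 (1 : ℝ) : EuclideanSpace ℝ (Fin 3))) = (Pi.single 0 ((4 * n : ℕ) : ℤ) : Site 3)
    exact latticeApprox_smul_e0_eq _ _ (by push_cast; ring)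

/-- Lattice shadow of `update 𝔵₀ 1 y[n, a]` at mesh `1/(2n)`: the axis sites `(0, a, 2n, 4n)·e₀`. [folklore] -/
theorem latticeApprox_update {n : ℕ} (a : ℕ) (hn : 1 ≤ n) :
    (fun i => latticeApprox ((2 * n : ℕ) : ℝ)⁻¹ (Function.update (fun i : Fin 4 => ((![0, 1 / 2, 1, 2] : Fin 4 → ℝ) i) • (EuclideanSpace.single 0 (1 : ℝ) : EuclideanSpace ℝ (Fin 3))) 1 (((a : ℝ) / ((2 * n : ℕ) : ℝ)) • (EuclideanSpace.single 0 (1 : ℝ) : EuclideanSpace ℝ (Fin 3))) i)) = ![(Pi.single 0 ((0 : ℕ) : ℤ) : Site 3), (Pi.single 0 (a : ℤ) : Site 3), (Pi.single 0 ((2 * n : ℕ) : ℤ) : Site 3), (Pi.single 0 ((4 * n : ℕ) : ℤ) : Site 3)] := by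
  have hn' : ((2 * n : ℕ) : ℝ) ≠ 0 := by positivity
  funext i
  fin_cases i
  · show latticeApprox ((2 * n : ℕ) : ℝ)⁻¹ (Function.update (fun i : Fin 4 => ((![0, 1 / 2, 1, 2] : Fin 4 → ℝ) i) • (EuclideanSpace.single 0 (1 : ℝ) : EuclideanSpace ℝ (Fin 3))) 1 (((a : ℝ) / ((2 * n : ℕ) : ℝ)) • (EuclideanSpace.single 0 (1 : ℝ) : EuclideanSpace ℝ (Fin 3))) 0) = (Pi.single 0 ((0 : ℕ) : ℤ) : Site 3)
    rw [Function.update_of_ne (by decide)]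
    show latticeApprox ((2 * n : ℕ) : ℝ)⁻¹ ((0 : ℝ) • (EuclideanSpace.single 0 (1 : ℝ) : EuclideanSpace ℝ (Fin 3))) = (Pi.single 0 ((0 : ℕ) : ℤ) : Site 3)
    exact latticeApprox_smul_e0_eq _ _ (by simp)
  · show latticeApprox ((2 * n : ℕ) : ℝ)⁻¹ (Function.update (fun i : Fin 4 => ((![0, 1 / 2, 1, 2] : Fin 4 → ℝ) i) • (EuclideanSpace.single 0 (1 : ℝ) : EuclideanSpace ℝ (Fin 3))) 1 (((a : ℝ) / ((2 * n : ℕ) : ℝ)) • (EuclideanSpace.single 0 (1 : ℝ) : EuclideanSpace ℝ (Fin 3))) 1) = (Pi.single 0 (a : ℤ) : Site 3)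
    rw [Function.update_self]
    exact latticeApprox_smul_e0_eq _ _ (by field_simp)
  · show latticeApprox ((2 * n : ℕ) : ℝ)⁻¹ (Function.update (fun i : Fin 4 => ((![0, 1 / 2, 1, 2] : Fin 4 → ℝ) i) • (EuclideanSpace.single 0 (1 : ℝ) : EuclideanSpace ℝ (Fin 3))) 1 (((a : ℝ) / ((2 * n : ℕ) : ℝ)) • (EuclideanSpace.single 0 (1 : ℝ) : EuclideanSpace ℝ (Fin 3))) 2) = (Pi.single 0 ((2 * n : ℕ) : ℤ) : Site 3)
    rw [Function.update_of_ne (by decide)]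
    show latticeApprox ((2 * n : ℕ) : ℝ)⁻¹ ((1 : ℝ) • (EuclideanSpace.single 0 (1 : ℝ) : EuclideanSpace ℝ (Fin 3))) = (Pi.single 0 ((2 * n : ℕ) : ℤ) : Site 3)
    exact latticeApprox_smul_e0_eq _ _ (by ring)
  · show latticeApprox ((2 * n : ℕ) : ℝ)⁻¹ (Function.update (fun i : Fin 4 => ((![0, 1 / 2, 1, 2] : Fin 4 → ℝ) i) • (EuclideanSpace.single 0 (1 : ℝ) : EuclideanSpace ℝ (Fin 3))) 1 (((a : ℝ) / ((2 * n : ℕ) : ℝ)) • (EuclideanSpace.single 0 (1 : ℝ) : EuclideanSpace ℝ (Fin 3))) 3) = (Pi.single 0 ((4 * n : ℕ) : ℤ) : Site 3)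
    rw [Function.update_of_ne (by decide)]
    show latticeApprox ((2 * n : ℕ) : ℝ)⁻¹ ((2 : ℝ) • (EuclideanSpace.single 0 (1 : ℝ) : EuclideanSpace ℝ (Fin 3))) = (Pi.single 0 ((4 * n : ℕ) : ℤ) : Site 3)
    exact latticeApprox_smul_e0_eq _ _ (by push_cast; ring)

/-! ### The two rescaled correlators at mesh `1/(2n)` -/

/-- `ρ★(1/(2n))⁴ = g[2n]^{-2}`. [folklore] -/
theorem rhoStar_mesh_pow_four (n : ℕ) :
    ((criticalTwoPoint 3 (Pi.single 0 ⌊(((2 * n : ℕ) : ℝ)⁻¹)⁻¹⌋)) ^ (-(1/2:ℝ))) ^ 4 = (criticalTwoPoint 3 (Pi.single 0 ((2 * n : ℕ) : ℤ)) ^ 2)⁻¹ := by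
  rw [inv_inv, Int.floor_natCast, ← Real.rpow_natCast, ← Real.rpow_mul (criticalTwoPoint_axis_pos _).le,
    show (-(1/2:ℝ)) * ((4:ℕ):ℝ) = -2 by norm_num, Real.rpow_neg (criticalTwoPoint_axis_pos _).le, Real.rpow_two]

/-- `F₄^δ(𝔵₀) ≤ 4 g[n]/g[2n] + 1` at `δ = 1/(2n)`. [cite: AizenmanDuminilCopinAnnals2021, eq. (3.12)] -/
theorem F_x0_le {n : ℕ} (hn : 1 ≤ n) :
    rescaledCorrelator (criticalCorr 3) (fun δ : ℝ => (criticalTwoPoint 3 (Pi.single 0 ⌊δ⁻¹⌋)) ^ (-(1/2:ℝ))) 4 ((2 * n : ℕ) : ℝ)⁻¹ (fun i : Fin 4 => ((![0, 1 / 2, 1, 2] : Fin 4 → ℝ) i) • (EuclideanSpace.single 0 (1 : ℝ) : EuclideanSpace ℝ (Fin 3))) ≤ 4 * criticalTwoPoint 3 (Pi.single 0 (n : ℤ)) / criticalTwoPoint 3 (Pi.single 0 ((2 * n : ℕ) : ℤ)) + 1 := by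
  rw [rescaledCorrelator_apply, rhoStar_mesh_pow_four, latticeApprox_x0 n]
  have hC := four_point_mid_le hn
  have hg2 := criticalTwoPoint_axis_pos (2 * n)
  calc (criticalTwoPoint 3 (Pi.single 0 ((2 * n : ℕ) : ℤ)) ^ 2)⁻¹ * criticalCorr 3 4 ![(Pi.single 0 ((0 : ℕ) : ℤ) : Site 3), (Pi.single 0 (n : ℤ) : Site 3), (Pi.single 0 ((2 * n : ℕ) : ℤ) : Site 3), (Pi.single 0 ((4 * n : ℕ) : ℤ) : Site 3)]
      ≤ (criticalTwoPoint 3 (Pi.single 0 ((2 * n : ℕ) : ℤ)) ^ 2)⁻¹ * (4 * criticalTwoPoint 3 (Pi.single 0 (n : ℤ)) * criticalTwoPoint 3 (Pi.single 0 ((2 * n : ℕ) : ℤ)) + criticalTwoPoint 3 (Pi.single 0 ((2 * n : ℕ) : ℤ)) ^ 2) :=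
        mul_le_mul_of_nonneg_left hC (by positivity)
    _ = 4 * criticalTwoPoint 3 (Pi.single 0 (n : ℤ)) / criticalTwoPoint 3 (Pi.single 0 ((2 * n : ℕ) : ℤ)) + 1 := by field_simp

/-- `F₄^δ(update 𝔵₀ 1 y) ≥ g[a]/g[2n] − 1` at `δ = 1/(2n)`, `y = (a/(2n))e₀`, `a ≤ n`.
[cite: AizenmanDuminilCopinAnnals2021, eq. (3.12)] -/
theorem F_update_ge {n a : ℕ} (hn : 1 ≤ n) (han : a ≤ n) :
    criticalTwoPoint 3 (Pi.single 0 (a : ℤ)) / criticalTwoPoint 3 (Pi.single 0 ((2 * n : ℕ) : ℤ)) - 1 ≤ rescaledCorrelator (criticalCorr 3) (fun δ : ℝ => (criticalTwoPoint 3 (Pi.single 0 ⌊δ⁻¹⌋)) ^ (-(1/2:ℝ))) 4 ((2 * n : ℕ) : ℝ)⁻¹ (Function.update (fun i : Fin 4 => ((![0, 1 / 2, 1, 2] : Fin 4 → ℝ) i) • (EuclideanSpace.single 0 (1 : ℝ) : EuclideanSpace ℝ (Fin 3))) 1 (((a : ℝ) / ((2 * n : ℕ) : ℝ)) • (EuclideanSpace.single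 0 (1 : ℝ) : EuclideanSpace ℝ (Fin 3)))) := by
  rw [rescaledCorrelator_apply, rhoStar_mesh_pow_four, latticeApprox_update a hn]
  have hC := four_point_retreat_ge hn han
  have hg2 := criticalTwoPoint_axis_pos (2 * n)
  calc criticalTwoPoint 3 (Pi.single 0 (a : ℤ)) / criticalTwoPoint 3 (Pi.single 0 ((2 * n : ℕ) : ℤ)) - 1 = (criticalTwoPoint 3 (Pi.single 0 ((2 * n : ℕ) : ℤ)) ^ 2)⁻¹ * (criticalTwoPoint 3 (Pi.single 0 (a : ℤ)) * criticalTwoPoint 3 (Pi.single 0 ((2 * n : ℕ) : ℤ)) - criticalTwoPoint 3 (Pi.single 0 ((2 * n : ℕ) : ℤ)) ^ 2) := by field_simp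
    _ ≤ (criticalTwoPoint 3 (Pi.single 0 ((2 * n : ℕ) : ℤ)) ^ 2)⁻¹ * criticalCorr 3 4 ![(Pi.single 0 ((0 : ℕ) : ℤ) : Site 3), (Pi.single 0 (a : ℤ) : Site 3), (Pi.single 0 ((2 * n : ℕ) : ℤ) : Site 3), (Pi.single 0 ((4 * n : ℕ) : ℤ) : Site 3)] :=
        mul_le_mul_of_nonneg_left hC (by positivity)

/-! ### Main theorems -/

/-- **The axial pincer: `NonSeparableModulus → TwoPointDoubling`** (item stmt-CriticalPhenomena-6152 ⟹ item
stmt-CriticalPhenomena-6150). If doubling fails at scale `n` with defect `g[2n]/g[n] < κ ≤ 8^{-p}`,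
reflection-positivity log-convexity propagates the defect one notch backwards (`8 g[n] ≤ g[n − J]`, retreat
`J = ⌊n/p⌋ + 1`), and the 4-point zoom at the caged midpoint configuration `(0, ½, 1, 2)·e₀`, mesh `1/(2n)`, jumps by
more than `1` under the retreat `½ ↦ (n−J)/(2n)` — against NS with `ε = 1`, whose non-separability hypothesis holds
at the caged midpoint for every `m > 0`. [cite: AizenmanDuminilCopinAnnals2021, eq. (3.12), Prop. 5.9, Remark 5.10] -/
theorem twoPointDoubling_of_nonSeparableModulus : Summit.CriticalPhenomena.Ising3DConformalLimit.Theses.MonotoneBlocking.NonSeparableModulus → Summit.CriticalPhenomena.Ising3DConformalLimit.Theses.MirrorHoelderCompactness.TwoPointDoubling := by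
  intro hNS
  by_contra hD
  -- (0) failure of doubling, in `g`-form
  have hD' : ∀ κ : ℝ, 0 < κ → ∃ n : ℕ, 1 ≤ n ∧ criticalTwoPoint 3 (Pi.single 0 ((2 * n : ℕ) : ℤ)) < κ * criticalTwoPoint 3 (Pi.single 0 (n : ℤ)) := by
    intro κ hκ
    by_contra hall
    push Not at hall
    apply hD
    refine ⟨κ, hκ, fun n hn => ?_⟩
    have h := hall n hn
    push_cast at h
    exact h
  -- (1) NS at n = 4, K = {𝔵₀}, ε = 1
  obtain ⟨m, η, δ₀, hm, hη, hδ₀, H⟩ :=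
    hNS 4 {(fun i : Fin 4 => ((![0, 1 / 2, 1, 2] : Fin 4 → ℝ) i) • (EuclideanSpace.single 0 (1 : ℝ) : EuclideanSpace ℝ (Fin 3)))} (Set.singleton_subset_iff.2 x0_mem) isCompact_singleton 1 one_pos
  -- (2) parameters: `p ≥ 2` with `1/η < p`, `N₀ ≥ 4` with `1/δ₀, 1/η < N₀`
  obtain ⟨p₀, hp₀⟩ := exists_nat_gt (1 / η)
  obtain ⟨N₁, hN₁⟩ := exists_nat_gt (max (1 / δ₀) (1 / η))
  have hp2 : 2 ≤ max p₀ 2 := le_max_right _ _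
  have hpη : 1 / η < ((max p₀ 2 : ℕ) : ℝ) := lt_of_lt_of_le hp₀ (by exact_mod_cast le_max_left _ _)
  have hN₀4 : 4 ≤ max N₁ 4 := le_max_right _ _
  have hN₁N₀ : (N₁ : ℝ) ≤ ((max N₁ 4 : ℕ) : ℝ) := by exact_mod_cast le_max_left _ _
  generalize hp : max p₀ 2 = p at hp2 hpη
  generalize hN₀ : max N₁ 4 = N₀ at hN₀4 hN₁N₀
  -- (3) the defect scale `n`, for `κ = g[2N₀]·8^{-p}` (so small that `n > N₀` is forced)
  have hκpos : 0 < criticalTwoPoint 3 (Pi.single 0 ((2 * N₀ : ℕ) : ℤ)) * (1 / 8 : ℝ) ^ p := mul_pos (criticalTwoPoint_axis_pos _) (by positivity)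
  obtain ⟨n, hn1, hlt⟩ := hD' _ hκpos
  have h8 : 0 ≤ (1 / 8 : ℝ) ^ p := by positivity
  have hκle : criticalTwoPoint 3 (Pi.single 0 ((2 * N₀ : ℕ) : ℤ)) * (1 / 8 : ℝ) ^ p ≤ (1 / 8 : ℝ) ^ p := by
    have := axis_le_one (2 * N₀)
    nlinarith
  have hnN₀ : N₀ < n := by
    by_contra hle
    push Not at hle
    have h1 : criticalTwoPoint 3 (Pi.single 0 ((2 * N₀ : ℕ) : ℤ)) ≤ criticalTwoPoint 3 (Pi.single 0 ((2 * n : ℕ) : ℤ)) := criticalTwoPoint_axis_antitone (by omega)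
    have h2 : criticalTwoPoint 3 (Pi.single 0 ((2 * n : ℕ) : ℤ)) < criticalTwoPoint 3 (Pi.single 0 ((2 * N₀ : ℕ) : ℤ)) * (1 / 8 : ℝ) ^ p := by
      have := axis_le_one n
      have := criticalTwoPoint_axis_pos n
      have := criticalTwoPoint_axis_pos (2 * N₀)
      nlinarith
    have h3 : criticalTwoPoint 3 (Pi.single 0 ((2 * N₀ : ℕ) : ℤ)) * (1 / 8 : ℝ) ^ p ≤ criticalTwoPoint 3 (Pi.single 0 ((2 * N₀ : ℕ) : ℤ)) := by
      have := criticalTwoPoint_axis_pos (2 * N₀)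
      have h8' : (1 / 8 : ℝ) ^ p ≤ 1 := pow_le_one₀ (by norm_num) (by norm_num)
      nlinarith
    linarith
  have hnreal : (N₀ : ℝ) < n := by exact_mod_cast hnN₀
  have hN₁n : (N₁ : ℝ) < n := lt_of_le_of_lt hN₁N₀ hnreal
  have hδ₀n : 1 / δ₀ < n := lt_of_le_of_lt (le_max_left _ _) (hN₁.trans hN₁n)
  have hηn : 1 / η < n := lt_of_le_of_lt (le_max_right _ _) (hN₁.trans hN₁n)
  have hnpos : (0 : ℝ) < n := by positivity
  have h2npos : (0 : ℝ) < ((2 * n : ℕ) : ℝ) := by positivity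
  -- (4) the mesh `1/(2n)` is admissible
  have hδlt : ((2 * n : ℕ) : ℝ)⁻¹ < δ₀ := by
    have h1 : δ₀⁻¹ < ((2 * n : ℕ) : ℝ) := by rw [← one_div]; push_cast; linarith
    exact (inv_lt_comm₀ h2npos hδ₀).2 h1
  -- (5) the retreat `J = q + 1`, `q = n / p`, and the retreated coordinate `a = n - J`
  obtain ⟨q, hq⟩ : ∃ q : ℕ, q = n / p := ⟨_, rfl⟩
  have hJn : q + 1 + 1 ≤ n := by
    have : q ≤ n / 2 := by rw [hq]; exact Nat.div_le_div_left hp2 (by norm_num)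
    omega
  have hpJ : n ≤ p * (q + 1) := by
    have h1 := Nat.div_add_mod n p
    rw [← hq] at h1
    have h2 := Nat.mod_lt n (by omega : 0 < p)
    rw [mul_add, mul_one]
    omega
  -- (6) the NS hypotheses at the retreated point
  have hnorm : ‖((((n - (q + 1) : ℕ) : ℝ) / ((2 * n : ℕ) : ℝ)) • (EuclideanSpace.single 0 (1 : ℝ) : EuclideanSpace ℝ (Fin 3))) - (fun i : Fin 4 => ((![0, 1 / 2, 1, 2] : Fin 4 → ℝ) i) • (EuclideanSpace.single 0 (1 : ℝ) : EuclideanSpace ℝ (Fin 3))) 1‖ < η := by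
    have hsub : ((((n - (q + 1) : ℕ) : ℝ) / ((2 * n : ℕ) : ℝ)) • (EuclideanSpace.single 0 (1 : ℝ) : EuclideanSpace ℝ (Fin 3))) - (fun i : Fin 4 => ((![0, 1 / 2, 1, 2] : Fin 4 → ℝ) i) • (EuclideanSpace.single 0 (1 : ℝ) : EuclideanSpace ℝ (Fin 3))) 1 = ((((n - (q + 1) : ℕ) : ℝ) / ((2 * n : ℕ) : ℝ)) - 1 / 2) • (EuclideanSpace.single 0 (1 : ℝ) : EuclideanSpace ℝ (Fin 3)) := by
      rw [sub_smul]
      simp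
    rw [hsub, norm_smul, Real.norm_eq_abs]
    have hval : (((n - (q + 1) : ℕ) : ℝ) / ((2 * n : ℕ) : ℝ)) - 1 / 2 = -((((q + 1 : ℕ) : ℝ)) / ((2 * n : ℕ) : ℝ)) := by
      rw [Nat.cast_sub (by omega)]
      field_simp
      push_cast
      ring
    rw [hval, abs_neg, abs_of_nonneg (by positivity)]
    have hJle : ((q : ℕ) : ℝ) + 1 ≤ (n : ℝ) / p + 1 := by
      have : ((q : ℕ) : ℝ) ≤ (n : ℝ) / p := by rw [hq]; exact Nat.cast_div_le
      linarith
    have hp_pos : (0 : ℝ) < p := by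
      have : (2 : ℝ) ≤ p := by exact_mod_cast hp2
      linarith
    have h1 : 1 / (p : ℝ) < η := (one_div_lt hp_pos hη).2 hpη
    have h2 : 1 / (n : ℝ) < η := (one_div_lt hnpos hη).2 hηn
    have hne : ‖(EuclideanSpace.single 0 (1 : ℝ) : EuclideanSpace ℝ (Fin 3))‖ = 1 := by simp
    rw [hne, mul_one]
    calc ((q + 1 : ℕ) : ℝ) / ((2 * n : ℕ) : ℝ) ≤ ((n : ℝ) / p + 1) / (2 * n) := by
          push_cast; exact div_le_div_of_nonneg_right hJle (by positivity)
      _ = (1 / p) / 2 + (1 / n) / 2 := by field_simp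
      _ < η / 2 + η / 2 := by linarith
      _ = η := by ring
  have hcaged : ¬ (∃ u : EuclideanSpace ℝ (Fin 3), (∃ i j : Fin 3, i ≠ j ∧
      (u = EuclideanSpace.single i 1 ∨ u = EuclideanSpace.single i 1 + EuclideanSpace.single j 1 ∨
        u = EuclideanSpace.single i 1 - EuclideanSpace.single j 1)) ∧
      ((∀ j : Fin 4, j ≠ 1 → inner ℝ u ((fun i : Fin 4 => ((![0, 1 / 2, 1, 2] : Fin 4 → ℝ) i) • (EuclideanSpace.single 0 (1 : ℝ) : EuclideanSpace ℝ (Fin 3))) j) + m ≤ inner ℝ u ((fun i : Fin 4 => ((![0, 1 / 2, 1, 2] : Fin 4 → ℝ) i) • (EuclideanSpace.single 0 (1 : ℝ) : EuclideanSpace ℝ (Fin 3))) 1)) ∨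
       (∀ j : Fin 4, j ≠ 1 → inner ℝ u ((fun i : Fin 4 => ((![0, 1 / 2, 1, 2] : Fin 4 → ℝ) i) • (EuclideanSpace.single 0 (1 : ℝ) : EuclideanSpace ℝ (Fin 3))) 1) + m ≤ inner ℝ u ((fun i : Fin 4 => ((![0, 1 / 2, 1, 2] : Fin 4 → ℝ) i) • (EuclideanSpace.single 0 (1 : ℝ) : EuclideanSpace ℝ (Fin 3))) j)))) := by
    rintro ⟨u, -, hsep⟩
    exact x0_caged hm u hsep
  -- (7) apply NS and evaluate both sides
  have key := H ((2 * n : ℕ) : ℝ)⁻¹ ⟨by positivity, hδlt⟩ (fun i : Fin 4 => ((![0, 1 / 2, 1, 2] : Fin 4 → ℝ) i) • (EuclideanSpace.single 0 (1 : ℝ) : EuclideanSpace ℝ (Fin 3))) rfl 1 ((((n - (q + 1) : ℕ) : ℝ) / ((2 * n : ℕ) : ℝ)) • (EuclideanSpace.single 0 (1 : ℝ) : EuclideanSpace ℝ (Fin 3))) hnorm hcaged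
  have hA := F_update_ge (n := n) (a := n - (q + 1)) hn1 (by omega)
  have hB := F_x0_le hn1
  have hdiff := (abs_lt.1 key).2
  have h3 : criticalTwoPoint 3 (Pi.single 0 ((n - (q + 1) : ℕ) : ℤ)) / criticalTwoPoint 3 (Pi.single 0 ((2 * n : ℕ) : ℤ)) < 4 * criticalTwoPoint 3 (Pi.single 0 (n : ℤ)) / criticalTwoPoint 3 (Pi.single 0 ((2 * n : ℕ) : ℤ)) + 3 := by linarith
  have h4 : criticalTwoPoint 3 (Pi.single 0 ((n - (q + 1) : ℕ) : ℤ)) < 4 * criticalTwoPoint 3 (Pi.single 0 (n : ℤ)) + 3 * criticalTwoPoint 3 (Pi.single 0 ((2 * n : ℕ) : ℤ)) := by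
    have hg2 := criticalTwoPoint_axis_pos (2 * n)
    rw [div_lt_iff₀ hg2] at h3
    have : (4 * criticalTwoPoint 3 (Pi.single 0 (n : ℤ)) / criticalTwoPoint 3 (Pi.single 0 ((2 * n : ℕ) : ℤ)) + 3) * criticalTwoPoint 3 (Pi.single 0 ((2 * n : ℕ) : ℤ)) = 4 * criticalTwoPoint 3 (Pi.single 0 (n : ℤ)) + 3 * criticalTwoPoint 3 (Pi.single 0 ((2 * n : ℕ) : ℤ)) := by field_simp
    linarith
  have h5 : criticalTwoPoint 3 (Pi.single 0 ((2 * n : ℕ) : ℤ)) ≤ criticalTwoPoint 3 (Pi.single 0 (n : ℤ)) := criticalTwoPoint_axis_antitone (by omega)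
  -- (8) the pincer's other jaw
  have h6 : 8 * criticalTwoPoint 3 (Pi.single 0 (n : ℤ)) ≤ criticalTwoPoint 3 (Pi.single 0 ((n - (q + 1) : ℕ) : ℤ)) := eight_mul_axis_le_of_ratio_lt hn1 hJn hpJ hκle hlt
  have := criticalTwoPoint_axis_pos n
  linarith

/-- **NS ⟺ item 6150**: with the landed converse (6150 ⟹ 4658 ⟹ 6152) the crux `NonSeparableModulus` is EXACTLY
all-scale axial doubling of the critical two-point function. [folklore] -/
theorem nonSeparableModulus_iff_twoPointDoubling : Summit.CriticalPhenomena.Ising3DConformalLimit.Theses.MonotoneBlocking.NonSeparableModulus ↔ Summit.CriticalPhenomena.Ising3DConformalLimit.Theses.MirrorHoelderCompactness.TwoPointDoubling :=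
  ⟨twoPointDoubling_of_nonSeparableModulus, fun hD =>
    Cruxes.ExistsScaleCovariantLimit.TwoHierarchies.stub_nonSeparableModulus_of_uniformRegularity
      (Cruxes.ExistsScaleCovariantLimit.TwoHierarchies.ItemMaps.uniformRegularity_of_doubling hD)⟩

/-- The `MirrorHoelderCompactness` copy of the equivalence (its `NonSeparableModulus` is the same proposition).
[folklore] -/
theorem mirror_nonSeparableModulus_iff_twoPointDoubling : Summit.CriticalPhenomena.Ising3DConformalLimit.Theses.MirrorHoelderCompactness.NonSeparableModulus ↔ Summit.CriticalPhenomena.Ising3DConformalLimit.Theses.MirrorHoelderCompactness.TwoPointDoubling :=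
  nonSeparableModulus_iff_twoPointDoubling

end Summit.CriticalPhenomena.Ising3DConformalLimit.MonotoneBlockingNonSeparableModulusAxialPincer

end
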